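import Summits.Schanuel.Schanuel.Theorems.ZilberEacDirectionalDominancePuncture
import Summits.Schanuel.Schanuel.Theorems.ZilberEacConeLatticeDirections
import Summits.Schanuel.Schanuel.Theorems.ZilberEacRealHyperplaneDensity
import Summits.Schanuel.Schanuel.Theorems.ZilberEacComplexPunctureDecoupling
import Literature.ModelTheory.Zilber.EACRotundityProofs
import HarnessLib

/-!
# Zariski density of the exponential points of the PUNCTURE-regime `(s+1)`-folds over graph
# hypersurfaces — Mantova–Masser's model 3-fold of `EC(3,2)` has Zariski dense exponential points

Zilber's Exponential-Algebraic Closedness, case ladder (host summit Schanuel, cell `pub-schanuel`,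
seat 2, gen 9).  THE FAMILY (`s ≥ 1`, the cell's first `(3,2)` family, gen 1):

  `W(g; a, b, F) = {x_{s+1} = g(x), yⱼ = aⱼ xⱼ + bⱼ + y_{s+1} Fⱼ(y_{s+1}, x) (j ≤ s)}`
  `⊆ ℂ^{s+1} × ℂ^{s+1}` (`fibredGraph g a b F`, `Fⱼ ∈ ℂ[u, x]` ARBITRARY),

whose exponential points are the solutions of `e^{xⱼ} = aⱼ xⱼ + bⱼ + e^{g(x)} Fⱼ(e^{g(x)}, x)`;
for `deg g ≥ 2` and all `aⱼ ≠ 0` a certified member of the open cell `EC(s+1, s)`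
(`ecCell_hypotheses_fibredGraph`).  `exists_expPoint_punctureDecoupling` (gen 1) solves the system
near the lattice centres of every ray `2πi m q` with `Re g_D(2πi q) < 0` (and `qⱼ ≠ 0` where
`aⱼ ≠ 0`).

**THEOREM (`unprojectedDense_fibredGraph_puncture`).**  `deg g ≥ 1`, one lattice direction `q₀`
with `Re g_D(2πi q₀) < 0` and all `q₀ⱼ ≠ 0`, `bⱼ ≠ 0` whenever `aⱼ = 0`, `Fⱼ` arbitrary ⟹
`I(W ∩ Γ_exp) = I(W)`: the exponential points are ZARISKI DENSE in the `(s+1)`-fold `W`.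

Proof: THEOREM J′ (`ZilberEacDirectionalDominancePuncture.unprojectedDense_of_directional_decay`)
with direction coordinates `x₁..x_s = 2πi m q + O(log m)` (`latticeCentre_control_of_leadingForm`
for the affine targets `aⱼXⱼ + bⱼ`) and the power coordinate `y_{s+1} = e^{g(x)}`,
`-log |y_{s+1}| = -Re g(x) ≥ (c₀/2) m^{D} ≫ log m` (`ExpDominant.eval_smul_near_top`); the admissible
rays — integer points of the open cone `Re g_D(2πi q) < 0` off the coordinate hyperplanes — are
Zariski dense (`coneLatticeDirections_dense`).

**COROLLARY (`mantovaMasserModel_member_dense`).**  Mantova–Masser's model system for the first open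
case of EAC (PLMS 2024, §1 p. 5), `e^z + e^{z²-w²} = z`, `e^w + e^{z²-w²} = -w`, i.e. the 3-fold
`W_MM = {x₂ = x₀² - x₁², y₀ = x₀ - y₂, y₁ = -x₁ - y₂}`: all seven hypotheses of `ECCell 3 2`, not
linearly split, `W_MM ∩ Γ_exp ≠ ∅` (gen 1) AND NOW `I(W_MM ∩ Γ_exp) = I(W_MM)` — its exponential
points are Zariski dense in it.

HONEST FRAMING: explicit families inside an OPEN cell; existence was gen 1's puncture decoupling,
NEW is the Zariski density in dimension `≥ 3`; `EC(3,2)` itself OPEN; NOT Schanuel's conjecture;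
EAC ⇏ SC.
-/

noncomputable section

open Complex MvPolynomial Filter Topology
open Literature.NumberTheory.Transcendental Literature.ModelTheory.Zilber
  Literature.ModelTheory.ExponentialFields

set_option linter.dupNamespace false

namespace Summit.Schanuel.Schanuel.Theorems

section Puncture

variable {s : ℕ}

/-- The exponential point of `W(g; a, b, F)` over a solution `x`. [folklore] -/
theorem fgParam_mem_expGraph_of_solution (g : MvPolynomial (Fin s) ℂ) (a b : Fin s → ℂ)
    (F : Fin s → MvPolynomial (Fin (s + 1)) ℂ) {x : Fin s → ℂ}
    (hx : ∀ j, exp (x j) = a j * x j + b j +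
      exp (eval x g) * eval (Fin.cons (exp (eval x g)) x) (F j)) :
    fgParam g a b F x (exp (eval x g)) ∈ expGraph ℂ (s + 1) := by
  rw [mem_expGraph_iff]
  intro i
  refine Fin.lastCases ?_ (fun j => ?_) i
  · rw [fgParam_inl_last, fgParam_inr, mulParam_last, ExponentialRing.complex_exp_eq]
  · rw [fgParam_inl_castSucc, fgParam_inr, mulParam_castSucc, ExponentialRing.complex_exp_eq, hx j]

/-- The affine target `aⱼ Xⱼ + bⱼ` as a linear form `Σᵢ lᵢ Xᵢ + bⱼ` with `l = single j aⱼ`.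
[folklore] -/
theorem C_mul_X_add_C_eq_linearForm (a b : ℂ) (j : Fin s) :
    (C a * X j + C b : MvPolynomial (Fin s) ℂ) = ∑ i, C (Pi.single j a i) * X i + C b := by
  rw [Finset.sum_eq_single j (fun i _ hij => by rw [Pi.single_eq_of_ne hij, C_0, zero_mul])
    (fun h => absurd (Finset.mem_univ j) h), Pi.single_eq_same]

/-- Leading forms of the affine targets `aⱼ Xⱼ + bⱼ` do not vanish at `v` when `vⱼ ≠ 0` for
`aⱼ ≠ 0` and `bⱼ ≠ 0` for `aⱼ = 0`. [folklore] -/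
theorem eval_leadingForm_affine_ne_zero {a b : ℂ} (j : Fin s) {v : Fin s → ℂ}
    (hav : a ≠ 0 → v j ≠ 0) (hab : a = 0 → b ≠ 0) :
    eval v (homogeneousComponent (C a * X j + C b : MvPolynomial (Fin s) ℂ).totalDegree
      (C a * X j + C b : MvPolynomial (Fin s) ℂ)) ≠ 0 := by
  by_cases ha : a = 0
  · subst ha
    simp only [C_0, zero_mul, zero_add, totalDegree_C, homogeneousComponent_zero, coeff_C,
      if_true, eval_C]
    exact hab rfl
  · rw [C_mul_X_add_C_eq_linearForm, eval_leadingForm_linearForm (Pi.single j a) b (k := j)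
      (by rwa [Pi.single_eq_same]), Finset.sum_eq_single j
      (fun i _ hij => by rw [Pi.single_eq_of_ne hij, zero_mul])
      (fun h => absurd (Finset.mem_univ j) h), Pi.single_eq_same]
    exact mul_ne_zero ha (hav ha)

/-- `m / log m → +∞`. [folklore] -/
theorem tendsto_natCast_div_log_atTop : Tendsto (fun m : ℕ => (m : ℝ) / Real.log m) atTop atTop := by
  have h0 : Tendsto (fun m : ℕ => Real.log m / m) atTop (𝓝 0) := by
    have h := (Real.isLittleO_log_id_atTop).tendsto_div_nhds_zero.comp tendsto_natCast_atTop_atTop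
    exact h
  have hpos : ∀ᶠ m : ℕ in atTop, 0 < Real.log m / m := by
    filter_upwards [eventually_gt_atTop 2] with m hm
    have hm' : (2 : ℝ) < m := by exact_mod_cast hm
    exact div_pos (Real.log_pos (by linarith)) (by linarith)
  have h1 : Tendsto (fun m : ℕ => Real.log m / m) atTop (𝓝[>] 0) :=
    tendsto_nhdsWithin_iff.2 ⟨h0, hpos⟩
  have h2 := tendsto_inv_nhdsGT_zero.comp h1
  refine h2.congr fun m => ?_
  simp only [Function.comp_apply, inv_div]

/-- **THEOREM (Zariski density in the puncture regime over graph hypersurfaces).**  See the module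
docstring. (new) [cite: MantovaMasser2023, §1 p.5 (the open case dim π(V) = 2 in ℂ³×ℂˣ³)] -/
theorem unprojectedDense_fibredGraph_puncture (g : MvPolynomial (Fin (s + 1)) ℂ)
    (hD : 0 < g.totalDegree) (q₀ : Fin (s + 1) → ℤ)
    (hq₀ : (eval (fun j => 2 * Real.pi * I * (q₀ j : ℂ))
      (homogeneousComponent g.totalDegree g)).re < 0)
    (hq₀0 : ∀ j, q₀ j ≠ 0) (a b : Fin (s + 1) → ℂ) (hab : ∀ j, a j = 0 → b j ≠ 0)
    (F : Fin (s + 1) → MvPolynomial (Fin (s + 2)) ℂ) :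
    UnprojectedDense (fibredGraph g a b F) := by
  classical
  have hLhom : (homogeneousComponent g.totalDegree g).IsHomogeneous g.totalDegree :=
    homogeneousComponent_isHomogeneous _ _
  -- the affine targets as polynomials
  set A : Fin (s + 1) → MvPolynomial (Fin (s + 1)) ℂ := fun j => C (a j) * X j + C (b j) with hA
  have hAeval : ∀ x : Fin (s + 1) → ℂ, ∀ j, eval x (A j) = a j * x j + b j := fun x j => by
    simp only [hA, map_add, map_mul, eval_C, eval_X]
  refine unprojectedDense_of_directional_decay (t := s + 1) (isIrreducibleClosed_fibredGraph g a b F)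
    (by rw [zariskiDim_fibredGraph]) (fun i => Sum.inl (Fin.castSucc i)) (Sum.inr (Fin.last (s + 1)))
    (Q := {v : Fin (s + 1) → ℂ | ∃ q : Fin (s + 1) → ℤ, (v = fun i => 2 * Real.pi * I * (q i : ℂ)) ∧
      (eval (fun i => 2 * Real.pi * I * (q i : ℂ)) (homogeneousComponent g.totalDegree g)).re < 0 ∧
      ∀ j, q j ≠ 0})
    (fun G hG => ?_) ?_
  · obtain ⟨q, hq, hq0, hGq⟩ := coneLatticeDirections_dense hLhom hq₀ hq₀0 G hG
    exact ⟨_, ⟨q, rfl, hq, hq0⟩, hGq⟩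
  rintro v ⟨q, rfl, hq, hq0⟩
  -- existence along the ray, and a choice of solutions
  obtain ⟨m₀, hm₀⟩ := exists_expPoint_punctureDecoupling g hD q hq a b (fun j _ => hq0 j) hab F
  set good : ℕ → (Fin (s + 1) → ℂ) → Prop := fun m x =>
    ‖x - fun j => (m : ℂ) * (2 * Real.pi * I * (q j : ℂ)) +
        log (a j * ((m : ℂ) * (2 * Real.pi * I * (q j : ℂ))) + b j)‖ ≤ 1 / 2 ∧
      ∀ j, exp (x j) = a j * x j + b j + exp (eval x g) * eval (Fin.cons (exp (eval x g)) x) (F j)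
    with hgood
  set xs : ℕ → Fin (s + 1) → ℂ := fun m => Classical.epsilon (good m) with hxs
  have hxs : ∀ᶠ m : ℕ in atTop, good m (xs m) := by
    filter_upwards [eventually_ge_atTop m₀] with m hm
    exact Classical.epsilon_spec (hm₀ m hm)
  set p : ℕ → Fin (s + 2) ⊕ Fin (s + 2) → ℂ := fun m =>
    fgParam g a b F (xs m) (exp (eval (xs m) g)) with hp
  -- lattice-centre control for the affine targets
  have hAlead : ∀ j, eval (fun i => 2 * Real.pi * I * (q i : ℂ))
      (homogeneousComponent (A j).totalDegree (A j)) ≠ 0 := fun j =>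
    eval_leadingForm_affine_ne_zero j
      (fun _ => mul_ne_zero Complex.two_pi_I_ne_zero (by exact_mod_cast hq0 j)) (hab j)
  obtain ⟨K, hK0, hK⟩ := latticeCentre_control_of_leadingForm A _
    (fun i => re_two_pi_I_mul_int (q i)) hAlead
  have hxv : ∀ᶠ m : ℕ in atTop,
      ‖xs m - fun i => (m : ℂ) * (2 * Real.pi * I * (q i : ℂ))‖ ≤ K * Real.log m := by
    filter_upwards [hxs, hK] with m hm hKm
    have h1 := hm.1
    refine (hKm (xs m) ?_).1
    simp only [hAeval]
    exact h1
  refine ⟨p, ?_, ⟨K, ?_⟩, ?_, ?_⟩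
  · -- points of `W ∩ Γ_exp`
    filter_upwards [hxs] with m hm
    exact ⟨fgParam_mem g a b F _ _, fgParam_mem_expGraph_of_solution g a b F hm.2⟩
  · -- direction coordinates
    filter_upwards [hxv] with m hm
    have hcoord : (fun i => p m (Sum.inl (Fin.castSucc i))) = xs m := by
      funext i; simp [hp]
    rw [hcoord]
    exact hm
  · -- the power coordinate is nonzero
    filter_upwards with m
    simp only [hp, fgParam_inr, mulParam_last]
    exact Complex.exp_ne_zero _
  · -- super-polynomial decay of `y_{s+1} = e^{g(x)}`
    set c₀ : ℝ := -(eval (fun i => 2 * Real.pi * I * (q i : ℂ))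
      (homogeneousComponent g.totalDegree g)).re with hc₀
    have hc₀pos : 0 < c₀ := by rw [hc₀]; linarith
    obtain ⟨ρ, hρ, t₀, ht₀, hnear⟩ :=
      ExpDominant.eval_smul_near_top g (fun i => 2 * Real.pi * I * (q i : ℂ)) (half_pos hc₀pos)
    have hρm := eventually_le_mul_of_le_log hxv ρ hρ
    have hbound : ∀ᶠ m : ℕ in atTop, c₀ / 2 * m ≤ -Real.log ‖p m (Sum.inr (Fin.last (s + 1)))‖ := by
      filter_upwards [hρm, tendsto_natCast_atTop_atTop.eventually_ge_atTop t₀,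
        eventually_ge_atTop 1] with m hm hmt hm1
      have hm0 : (m : ℂ) ≠ 0 := by exact_mod_cast (show m ≠ 0 by omega)
      have hm0r : (0 : ℝ) < m := by exact_mod_cast (show 0 < m by omega)
      simp only [hp, fgParam_inr, mulParam_last, Complex.norm_exp, Real.log_exp]
      -- `x = m • (v + ζ)` with `‖ζ‖ ≤ ρ`
      set ζ : Fin (s + 1) → ℂ := fun i =>
        (xs m i - (m : ℂ) * (2 * Real.pi * I * (q i : ℂ))) / (m : ℂ) with hζ
      have hζnorm : ‖ζ‖ ≤ ρ := by
        refine (pi_norm_le_iff_of_nonneg hρ.le).2 fun i => ?_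
        rw [hζ]
        dsimp only
        rw [norm_div, Complex.norm_natCast, div_le_iff₀ hm0r]
        exact (norm_le_pi_norm (xs m - fun i => (m : ℂ) * (2 * Real.pi * I * (q i : ℂ))) i).trans hm
      have hxζ : ((m : ℝ) : ℂ) • ((fun i => 2 * Real.pi * I * (q i : ℂ)) + ζ) = xs m := by
        funext i
        simp only [Pi.smul_apply, Pi.add_apply, smul_eq_mul, hζ, Complex.ofReal_natCast]
        field_simp
        ring
      have hn := hnear m hmt ζ hζnorm
      rw [hxζ] at hn
      have hre : (eval (xs m) g).re ≤ (((m : ℝ) : ℂ) ^ g.totalDegree *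
          eval (fun i => 2 * Real.pi * I * (q i : ℂ)) (homogeneousComponent g.totalDegree g)).re +
          ‖eval (xs m) g - ((m : ℝ) : ℂ) ^ g.totalDegree *
            eval (fun i => 2 * Real.pi * I * (q i : ℂ)) (homogeneousComponent g.totalDegree g)‖ := by
        have h := Complex.re_le_norm (eval (xs m) g - ((m : ℝ) : ℂ) ^ g.totalDegree *
          eval (fun i => 2 * Real.pi * I * (q i : ℂ)) (homogeneousComponent g.totalDegree g))
        rw [Complex.sub_re] at h
        linarith
      have hre2 : (((m : ℝ) : ℂ) ^ g.totalDegree * eval (fun i => 2 * Real.pi * I * (q i : ℂ))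
          (homogeneousComponent g.totalDegree g)).re = -(c₀ * (m : ℝ) ^ g.totalDegree) := by
        rw [← Complex.ofReal_pow, Complex.re_ofReal_mul, hc₀]; ring
      have hpow : (m : ℝ) ≤ (m : ℝ) ^ g.totalDegree := by
        have := pow_le_pow_right₀ (by exact_mod_cast hm1 : (1 : ℝ) ≤ m) hD
        rwa [pow_one] at this
      nlinarith [hre, hre2, hn, hpow, hc₀pos]
    refine tendsto_atTop_mono' atTop ?_
      ((tendsto_natCast_div_log_atTop).const_mul_atTop (half_pos hc₀pos))
    filter_upwards [hbound, eventually_gt_atTop 2] with m hm hm2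
    have hlog : 0 < Real.log m := Real.log_pos (by exact_mod_cast (show 1 < m by omega))
    rw [mul_div_assoc', le_div_iff₀ hlog, div_mul_cancel₀ _ hlog.ne']
    exact hm

end Puncture

/-! ## Mantova–Masser's model 3-fold -/

section Model

/-- The data of Mantova–Masser's model system: `g = X₀² - X₁²` is homogeneous of degree `2` with
`Re g(2πi(2,1)) = -12π² < 0`. [cite: MantovaMasser2023, §1 p.5 (displayed system for dim π(V) = 2 in ℂ³×ℂˣ³)] -/
theorem mantovaMasserModel_data :
    (X 0 ^ 2 - X 1 ^ 2 : MvPolynomial (Fin 2) ℂ).totalDegree = 2 ∧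
    (eval (fun j => 2 * Real.pi * I * ((![2, 1] : Fin 2 → ℤ) j : ℂ))
      (homogeneousComponent (X 0 ^ 2 - X 1 ^ 2 : MvPolynomial (Fin 2) ℂ).totalDegree
        (X 0 ^ 2 - X 1 ^ 2 : MvPolynomial (Fin 2) ℂ))).re < 0 := by
  set g : MvPolynomial (Fin 2) ℂ := X 0 ^ 2 - X 1 ^ 2 with hg
  have hhom : g.IsHomogeneous 2 := (isHomogeneous_X_pow 0 2).sub (isHomogeneous_X_pow 1 2)
  have heval : ∀ x : Fin 2 → ℂ, eval x g = x 0 ^ 2 - x 1 ^ 2 := fun x => by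
    simp [hg, map_sub, map_pow, eval_X]
  have hg0 : g ≠ 0 := by
    intro h
    have := heval ![1, 0]
    rw [h, map_zero] at this
    norm_num at this
  have hdeg : g.totalDegree = 2 := hhom.totalDegree hg0
  refine ⟨hdeg, ?_⟩
  rw [hdeg, homogeneousComponent_eq_self hhom, heval]
  have h1 : (2 * (Real.pi : ℂ) * I * (((![2, 1] : Fin 2 → ℤ) 0 : ℤ) : ℂ)) ^ 2 -
      (2 * Real.pi * I * (((![2, 1] : Fin 2 → ℤ) 1 : ℤ) : ℂ)) ^ 2 = ((-12 * Real.pi ^ 2 : ℝ) : ℂ) := by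
    simp only [Matrix.cons_val_zero, Matrix.cons_val_one]
    push_cast
    ring_nf
    rw [Complex.I_sq]
    ring
  rw [h1, Complex.ofReal_re]
  have := Real.pi_pos
  nlinarith

/-- **Mantova–Masser's model 3-fold has Zariski dense exponential points.**
`W_MM = {x₂ = x₀² - x₁², y₀ = x₀ - y₂, y₁ = -x₁ - y₂} ⊆ ℂ³ × ℂ³` (`fibredGraph (X₀² - X₁²) (1,-1)
(0,0) (-1,-1)`), whose exponential points are the solutions of the displayed system
`e^z + e^{z²-w²} = z`, `e^w + e^{z²-w²} = -w` of Mantova–Masser (PLMS 2024, §1 p. 5, "the simplest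
case of dimension 2 in `ℂ³ × ℂˣ³`"): `I(W_MM ∩ Γ_exp) = I(W_MM)`. (new)
[cite: MantovaMasser2023, §1 p.5 (displayed system for dim π(V) = 2 in ℂ³×ℂˣ³)] -/
theorem unprojectedDense_mantovaMasserModel :
    UnprojectedDense (fibredGraph (X 0 ^ 2 - X 1 ^ 2 : MvPolynomial (Fin 2) ℂ) ![1, -1] ![0, 0]
      (fun _ => C (-1))) := by
  obtain ⟨hdeg, hq⟩ := mantovaMasserModel_data
  exact unprojectedDense_fibredGraph_puncture _ (by rw [hdeg]; exact two_pos) ![2, 1] hq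
    (fun j => by fin_cases j <;> simp) _ _ (fun j => by fin_cases j <;> simp) _

/-- **Mantova–Masser's model 3-fold is a certified member of the open cell `EC(3,2)` whose
exponential points are Zariski dense**: all seven hypotheses of `ECCell 3 2`, not linearly split
(non-split part of the cell), `W_MM ∩ Γ_exp ≠ ∅` (the cell's gen-1 theorem, here re-derived from
density) and `I(W_MM ∩ Γ_exp) = I(W_MM)`. (new)
[cite: MantovaMasser2023, §1 p.5 (displayed system for dim π(V) = 2 in ℂ³×ℂˣ³)] -/
theorem mantovaMasserModel_member_dense :
    (IsIrreducibleClosed ℂ (fibredGraph (X 0 ^ 2 - X 1 ^ 2 : MvPolynomial (Fin 2) ℂ) ![1, -1] ![0, 0]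
        (fun _ => C (-1))) ∧
      (fibredGraph (X 0 ^ 2 - X 1 ^ 2 : MvPolynomial (Fin 2) ℂ) ![1, -1] ![0, 0] (fun _ => C (-1)) ∩
        torusLocus ℂ 3).Nonempty ∧
      IsRotund ℂ 3 (fibredGraph (X 0 ^ 2 - X 1 ^ 2 : MvPolynomial (Fin 2) ℂ) ![1, -1] ![0, 0]
        (fun _ => C (-1)) ∩ torusLocus ℂ 3) ∧
      IsAddFree ℂ 3 (fibredGraph (X 0 ^ 2 - X 1 ^ 2 : MvPolynomial (Fin 2) ℂ) ![1, -1] ![0, 0]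
        (fun _ => C (-1)) ∩ torusLocus ℂ 3) ∧
      IsMulFree ℂ 3 (fibredGraph (X 0 ^ 2 - X 1 ^ 2 : MvPolynomial (Fin 2) ℂ) ![1, -1] ![0, 0]
        (fun _ => C (-1)) ∩ torusLocus ℂ 3) ∧
      zariskiDim ℂ (fibredGraph (X 0 ^ 2 - X 1 ^ 2 : MvPolynomial (Fin 2) ℂ) ![1, -1] ![0, 0]
        (fun _ => C (-1))) = (3 : ℕ) ∧
      addProjDim ℂ 3 (fibredGraph (X 0 ^ 2 - X 1 ^ 2 : MvPolynomial (Fin 2) ℂ) ![1, -1] ![0, 0]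
        (fun _ => C (-1))) = (2 : ℕ)) ∧
    ¬ IsLinearSplit ℂ 3 (fibredGraph (X 0 ^ 2 - X 1 ^ 2 : MvPolynomial (Fin 2) ℂ) ![1, -1] ![0, 0]
        (fun _ => C (-1))) ∧
    (fibredGraph (X 0 ^ 2 - X 1 ^ 2 : MvPolynomial (Fin 2) ℂ) ![1, -1] ![0, 0] (fun _ => C (-1)) ∩
        expGraph ℂ 3).Nonempty ∧
    UnprojectedDense (fibredGraph (X 0 ^ 2 - X 1 ^ 2 : MvPolynomial (Fin 2) ℂ) ![1, -1] ![0, 0]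
        (fun _ => C (-1))) := by
  obtain ⟨hdeg, -⟩ := mantovaMasserModel_data
  have ha : ∀ j : Fin 2, (![(1 : ℂ), -1] : Fin 2 → ℂ) j ≠ 0 := fun j => by fin_cases j <;> simp
  have hcell := ecCell_hypotheses_fibredGraph (X 0 ^ 2 - X 1 ^ 2 : MvPolynomial (Fin 2) ℂ) ![1, -1]
    ![0, 0] (fun _ => C (-1)) ha (by rw [hdeg])
  have hdense := unprojectedDense_mantovaMasserModel
  refine ⟨hcell, not_isLinearSplit_fibredGraph _ _ _ _ two_pos (by simp), ?_, hdense⟩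
  obtain ⟨w, hw, -⟩ := hcell.2.1
  exact inter_expGraph_nonempty_of_vanishingIdeal_eq ⟨w, hw⟩ hdense

end Model

end Summit.Schanuel.Schanuel.Theorems

end
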